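import Literature.AlgebraicGeometry.ModuliOfAbelianVarieties.SiegelCMSpecialTypeUnique
import Mathlib.LinearAlgebra.Eigenspace.Pi
import Mathlib.Algebra.DirectSum.Module
import HarnessLib

/-!
# The eigenline decomposition of a CM structure is a LINE decomposition
# ([Shimura 1998] §5.1 Lemma 1; [Milne CM] I §1: `V ⊗ ℂ = ⊕_φ V_φ`, `dim V_φ = 1`)

Topic `AlgebraicGeometry/ModuliOfAbelianVarieties`; namespace
`Literature.AlgebraicGeometry.ModuliOfAbelianVarieties.CMStructure`.  THEOREMS ONLY (no definition, no named fact, no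
instance, no `sorry`; net Literature debt **0**).  Sequel of ★ (σ4)-D `SiegelCanonicalModel` (`CMStructure`), ★ R60-10
`SiegelCMSpecialPointUnique` (`iSup_eigenline_eq_top`: the common eigenlines SPAN) and ★ R60-23 `SiegelCMSpecialTypeUnique`
(`eigenline_ne_bot`: every eigenline is NON-ZERO).  Cell hodgecm-mathlib (D-0151), banked GENERIC leaf R60-36 toward fan-B row
I-7 (#60) `SiegelS1` (director g6 RULING s86 (2)(b); A-p05 TABLE v1.12 «(R60-36) eigenline decomposition is a LINE
decomposition»; the dimension input of MUMFORD-LINE-SPEC §3 step 3 / R60-33 `SiegelCMSpecialPairPeriodIso`).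

WHAT IS PROVED.  Let `c` be a CM structure of type `δ` ([Deligne1971TravauxShimura] 4.18): `act : F = ∏ᵢ Kᵢ → End_ℚ(ℚ^{2g})`
injective with `Σᵢ [Kᵢ : ℚ] = 2g`; `V_{i,ρ} = ⋂_{x ∈ Kᵢ} Eig(act(ιᵢ x) ⊗ ℂ, ρ(x)) ⊆ ℂ^{2g}` the common eigenline of the factor `Kᵢ`
with character `ρ : Kᵢ → ℂ`, indexed by `q = ⟨i, ρ⟩ : Σ i, (Kᵢ →+* ℂ)` exactly as in ★ `iSup_eigenline_eq_top`.
* §1 `iSupIndep_eigenline` — the eigenlines are INDEPENDENT: they refine the simultaneous (generalised) eigenspaces of the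
  commuting family `z ↦ act(z) ⊗ ℂ`, `z ∈ F`, for the pairwise distinct characters `χ_{i,ρ}(z) = ρ(zᵢ)` (Mathlib
  `Module.End.independent_iInf_maxGenEigenspace_of_forall_mapsTo`); with ★ `iSup_eigenline_eq_top`:
  `isInternal_eigenline` — `ℂ^{2g} = ⨁_{(i,ρ)} V_{i,ρ}` (`DirectSum.IsInternal`).
* §2 `card_sigma_embeddings` — `#{(i,ρ)} = Σᵢ #(Kᵢ →+* ℂ) = Σᵢ [Kᵢ : ℚ] = 2g` (Mathlib `NumberField.Embeddings.card`,
  `c.sum_finrank_eq`); `sum_finrank_eigenline_eq` — `Σ_{(i,ρ)} dim V_{i,ρ} = 2g` (collected basis of the internal direct sum).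
* §3 HEAD **`finrank_eigenline_eq_one`** — `dim_ℂ V_{i,ρ} = 1` for EVERY `(i, ρ)`: `2g` summands, each `≥ 1` (★ R60-23
  `eigenline_ne_bot`), summing to `2g`.  And `exists_eigenline_eq_span` — `V_{i,ρ} = ℂ·v` for a non-zero common eigenvector `v`.
  [Shimura1998] §5.1 Lemma 1 / [MilneCM2006] I §1: for `V` free of rank one over the CM algebra `F`, `V ⊗_ℚ ℂ = ⊕_φ V_φ` with
  every `V_φ` a LINE; [Milne2005ShimuraVarieties] Ex. 12.4 (b) (`V_φ` is the `φ`-eigenline on which `h_Φ` is read).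
Nothing printed is asserted.  HC_CM is proved only modulo the 7 printed citations until rung 0 closes.

## References
* [Deligne1971TravauxShimura] P. Deligne, *Travaux de Shimura*, Sém. Bourbaki 389 (1971), 4.18 p. 150.
* [Shimura1998] G. Shimura, *Abelian Varieties with Complex Multiplication and Modular Functions* (1998), §5.1 Lemma 1.
* [MilneCM2006] J. S. Milne, *Complex Multiplication* (2006), Ch. I §1 (CM algebras, `E ⊗ ℂ ≅ ∏_φ ℂ`).
* [Milne2005ShimuraVarieties] J. S. Milne, *Introduction to Shimura varieties* (2005), Ex. 12.4 (b) p. 112.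
-/

set_option autoImplicit false

noncomputable section

open Matrix NumberField Polynomial
open scoped IntermediateField

namespace Literature.AlgebraicGeometry.ModuliOfAbelianVarieties

namespace CMStructure

open Literature.AlgebraicGeometry.Motives (CMType)

variable {g : ℕ} {δ : Fin g → ℕ} {ι : Type} [Fintype ι] [DecidableEq ι] {K : ι → Type} [∀ i, Field (K i)]
  [∀ i, NumberField (K i)] [∀ i, IsCMField (K i)] (c : CMStructure g δ ι K)

/-! ### §1. The eigenlines are independent; `ℂ^{2g}` is their internal direct sum -/

/-- **THE EIGENLINES ARE INDEPENDENT** ([Shimura1998] §5.1 Lemma 1): the family `(i, ρ) ↦ V_{i,ρ}` of common eigenlines of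
the CM algebra `F = ∏ Kᵢ` on `ℂ^{2g}` is `iSupIndep`.  Proof: `V_{i,ρ}` lies in the simultaneous eigenspace of the commuting
family `z ↦ act(z) ⊗ ℂ` (`z ∈ F`) for the character `χ_{i,ρ}(z) = ρ(zᵢ)` (on `V_{i,ρ}` the idempotent `act(ιᵢ 1)` is the
identity, so `act(z) = act(ιᵢ zᵢ)` there); these characters are pairwise distinct (`χ_{i,ρ}(ιᵢ 1) = 1` pins `i`, then `ρ`),
and simultaneous generalised eigenspaces of a commuting family for distinct characters are independent (Mathlib).
[cite: Shimura1998, §5.1 Lemma 1] [cite: MilneCM2006, Ch. I §1] -/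
theorem iSupIndep_eigenline :
    iSupIndep fun q : Σ i, (K i →+* ℂ) => ⨅ x : K q.1,
      Module.End.eigenspace (Matrix.toLin' ((c.actMatrix (Pi.single q.1 x)).map (algebraMap ℚ ℂ))) (q.2 x) := by
  classical
  -- the complexified action as a `ℚ`-algebra homomorphism `A : F → M_{2g}(ℂ)`
  let A : (Π j, K j) →ₐ[ℚ] Matrix (Fin g ⊕ Fin g) (Fin g ⊕ Fin g) ℂ :=
    ((Algebra.ofId ℚ ℂ).mapMatrix.comp
        (LinearMap.toMatrixAlgEquiv' (R := ℚ) (n := Fin g ⊕ Fin g)).toAlgHom).comp c.act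
  have hA : ∀ z, A z = (c.actMatrix z).map (algebraMap ℚ ℂ) := fun z => rfl
  simp only [← hA]
  -- the commuting family `f z = act(z) ⊗ ℂ`, `z ∈ F`, and the characters `χ_{i,ρ}(z) = ρ (z i)`
  let f : (Π j, K j) → Module.End ℂ (Fin g ⊕ Fin g → ℂ) := fun z => Matrix.toLin' (A z)
  let χ : (Σ i, (K i →+* ℂ)) → ((Π j, K j) → ℂ) := fun q z => q.2 (z q.1)
  have hcomm : ∀ z w : Π j, K j, Commute (f z) (f w) := fun z w => by
    change Matrix.toLin' (A z) * Matrix.toLin' (A w) = Matrix.toLin' (A w) * Matrix.toLin' (A z)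
    rw [Module.End.mul_eq_comp, Module.End.mul_eq_comp, ← Matrix.toLin'_mul, ← Matrix.toLin'_mul, ← map_mul,
      ← map_mul, mul_comm]
  have hind : iSupIndep fun χ' : (Π j, K j) → ℂ => ⨅ z, (f z).maxGenEigenspace (χ' z) :=
    Module.End.independent_iInf_maxGenEigenspace_of_forall_mapsTo f
      (fun z w φ => Module.End.mapsTo_maxGenEigenspace_of_comm (hcomm w z) φ)
  have hχ : Function.Injective χ := by
    rintro ⟨i, ρ⟩ ⟨j, ρ'⟩ h
    have h1 : ∀ z : Π k, K k, ρ (z i) = ρ' (z j) := fun z => congr_fun h z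
    have hij : i = j := by
      by_contra hij
      have h2 := h1 (Pi.single i 1)
      rw [Pi.single_eq_same, Pi.single_eq_of_ne (Ne.symm hij), map_one, map_zero] at h2
      exact one_ne_zero h2
    subst hij
    have hρ : ρ = ρ' := RingHom.ext fun x => by simpa only [Pi.single_eq_same] using h1 (Pi.single i x)
    subst hρ
    rfl
  refine (hind.comp hχ).mono fun q => ?_
  obtain ⟨i, ρ⟩ := q
  intro v hv
  rw [Submodule.mem_iInf] at hv
  change v ∈ ⨅ z, (f z).maxGenEigenspace (ρ (z i))
  rw [Submodule.mem_iInf]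
  intro z
  apply Module.End.eigenspace_le_maxGenEigenspace
  rw [Module.End.mem_eigenspace_iff]
  have hv1 : A (Pi.single i 1) *ᵥ v = v := by
    have h := hv 1
    rw [Module.End.mem_eigenspace_iff, Matrix.toLin'_apply, map_one, one_smul] at h
    exact h
  have hvz : A (Pi.single i (z i)) *ᵥ v = ρ (z i) • v := by
    have h := hv (z i)
    rw [Module.End.mem_eigenspace_iff, Matrix.toLin'_apply] at h
    exact h
  have hz : z * Pi.single i 1 = Pi.single i (z i) := by
    rw [← Pi.single_mul_right (f := z) (1 : K i), mul_one]
  change Matrix.toLin' (A z) v = ρ (z i) • v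
  calc Matrix.toLin' (A z) v = A z *ᵥ (A (Pi.single i 1) *ᵥ v) := by rw [Matrix.toLin'_apply, hv1]
    _ = A (Pi.single i (z i)) *ᵥ v := by rw [Matrix.mulVec_mulVec, ← map_mul, hz]
    _ = ρ (z i) • v := hvz

open scoped Classical in
/-- **`ℂ^{2g}` IS THE INTERNAL DIRECT SUM OF THE EIGENLINES** `V_{i,ρ}` ([Shimura1998] §5.1 Lemma 1; [MilneCM2006] I §1
`V ⊗ ℂ = ⊕_φ V_φ`): independence (`iSupIndep_eigenline`) + spanning (★ `iSup_eigenline_eq_top`).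
[cite: Shimura1998, §5.1 Lemma 1] [cite: MilneCM2006, Ch. I §1] -/
theorem isInternal_eigenline :
    DirectSum.IsInternal fun q : Σ i, (K i →+* ℂ) => ⨅ x : K q.1,
      Module.End.eigenspace (Matrix.toLin' ((c.actMatrix (Pi.single q.1 x)).map (algebraMap ℚ ℂ))) (q.2 x) :=
  DirectSum.isInternal_submodule_of_iSupIndep_of_iSup_eq_top c.iSupIndep_eigenline c.iSup_eigenline_eq_top

/-! ### §2. Counting: `2g` eigenlines whose dimensions sum to `2g` -/

include c in
omit [DecidableEq ι] in
/-- The index set of the eigenlines has `2g` elements: `Σᵢ #(Kᵢ →+* ℂ) = Σᵢ [Kᵢ : ℚ] = 2g` (Mathlib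
`NumberField.Embeddings.card` and the `CMStructure` axiom `sum_finrank_eq`). [cite: Deligne1971TravauxShimura, 4.18 p. 150] -/
theorem card_sigma_embeddings : Fintype.card (Σ i, (K i →+* ℂ)) = 2 * g := by
  rw [Fintype.card_sigma]
  simp_rw [NumberField.Embeddings.card]
  exact c.sum_finrank_eq

/-- The dimensions of the eigenlines sum to `dim ℂ^{2g} = 2g` (collected basis of the internal direct sum
`isInternal_eigenline`). [cite: Shimura1998, §5.1 Lemma 1] [cite: MilneCM2006, Ch. I §1] -/
theorem sum_finrank_eigenline_eq :
    (∑ q : Σ i, (K i →+* ℂ), Module.finrank ℂ ↥(⨅ x : K q.1,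
      Module.End.eigenspace (Matrix.toLin' ((c.actMatrix (Pi.single q.1 x)).map (algebraMap ℚ ℂ))) (q.2 x))) = 2 * g := by
  classical
  have hint := c.isInternal_eigenline
  let b := hint.collectedBasis fun q => Module.finBasis ℂ _
  have h1 := Module.finrank_eq_card_basis b
  rw [Fintype.card_sigma] at h1
  simp only [Fintype.card_fin] at h1
  rw [← h1, Module.finrank_fintype_fun_eq_card, Fintype.card_sum, Fintype.card_fin, two_mul]

/-! ### §3. Every eigenline is a line -/

/-- **HEAD — EVERY EIGENLINE IS A LINE** ([Shimura1998] §5.1 Lemma 1; [MilneCM2006] I §1: `dim_ℂ V_φ = 1` for `V` free of rank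
one over the CM algebra; [Milne2005ShimuraVarieties] Ex. 12.4 (b)): for every factor `i` and every complex embedding
`ρ : Kᵢ → ℂ`, the common eigenline `V_{i,ρ} ⊆ ℂ^{2g}` of a CM structure has complex dimension exactly `1` — there are `2g`
eigenlines (`card_sigma_embeddings`), each non-zero (★ `eigenline_ne_bot`), and their dimensions sum to `2g`
(`sum_finrank_eigenline_eq`). [cite: Shimura1998, §5.1 Lemma 1] [cite: MilneCM2006, Ch. I §1]
[cite: Milne2005ShimuraVarieties, Ex. 12.4 (b) p. 112] -/
theorem finrank_eigenline_eq_one (i : ι) (ρ : K i →+* ℂ) :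
    Module.finrank ℂ ↥(⨅ x : K i,
      Module.End.eigenspace (Matrix.toLin' ((c.actMatrix (Pi.single i x)).map (algebraMap ℚ ℂ))) (ρ x)) = 1 := by
  classical
  -- every summand is `≥ 1`
  have hge : ∀ q : Σ j, (K j →+* ℂ), 1 ≤ Module.finrank ℂ ↥(⨅ x : K q.1,
      Module.End.eigenspace (Matrix.toLin' ((c.actMatrix (Pi.single q.1 x)).map (algebraMap ℚ ℂ))) (q.2 x)) :=
    fun q => Submodule.one_le_finrank_iff.mpr (c.eigenline_ne_bot q.1 q.2)
  -- if `V_{i,ρ}` had dimension `> 1` the sum would exceed the number `2g` of summands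
  by_contra hne
  have hgt : 1 < Module.finrank ℂ ↥(⨅ x : K i,
      Module.End.eigenspace (Matrix.toLin' ((c.actMatrix (Pi.single i x)).map (algebraMap ℚ ℂ))) (ρ x)) :=
    lt_of_le_of_ne (hge ⟨i, ρ⟩) (Ne.symm hne)
  have hlt : (∑ _q : Σ j, (K j →+* ℂ), 1) < ∑ q : Σ j, (K j →+* ℂ), Module.finrank ℂ ↥(⨅ x : K q.1,
      Module.End.eigenspace (Matrix.toLin' ((c.actMatrix (Pi.single q.1 x)).map (algebraMap ℚ ℂ))) (q.2 x)) :=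
    Finset.sum_lt_sum (fun q _ => hge q) ⟨⟨i, ρ⟩, Finset.mem_univ _, hgt⟩
  rw [Finset.sum_const, Finset.card_univ, smul_eq_mul, mul_one, c.card_sigma_embeddings, c.sum_finrank_eigenline_eq]
    at hlt
  exact lt_irrefl _ hlt

/-- **Every eigenline is spanned by one common eigenvector**: `V_{i,ρ} = ℂ·v` for some `v ≠ 0` with `act(ιᵢ x)·v = ρ(x)·v`
for all `x ∈ Kᵢ` (★ `exists_ne_zero_forall_mulVec_eq_smul` + `finrank_eigenline_eq_one`).
[cite: Shimura1998, §5.1 Lemma 1] [cite: MilneCM2006, Ch. I §1] -/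
theorem exists_eigenline_eq_span (i : ι) (ρ : K i →+* ℂ) :
    ∃ v : Fin g ⊕ Fin g → ℂ, v ≠ 0 ∧ (∀ x : K i, (c.actMatrix (Pi.single i x)).map (algebraMap ℚ ℂ) *ᵥ v = ρ x • v) ∧
      (⨅ x : K i, Module.End.eigenspace (Matrix.toLin' ((c.actMatrix (Pi.single i x)).map (algebraMap ℚ ℂ))) (ρ x)) =
        ℂ ∙ v := by
  obtain ⟨v, hv0, hv⟩ := c.exists_ne_zero_forall_mulVec_eq_smul i ρ
  refine ⟨v, hv0, hv, ?_⟩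
  have hmem : v ∈ ⨅ x : K i,
      Module.End.eigenspace (Matrix.toLin' ((c.actMatrix (Pi.single i x)).map (algebraMap ℚ ℂ))) (ρ x) := by
    rw [Submodule.mem_iInf]
    intro x
    rw [Module.End.mem_eigenspace_iff, Matrix.toLin'_apply]
    exact hv x
  have hle : (ℂ ∙ v) ≤ ⨅ x : K i,
      Module.End.eigenspace (Matrix.toLin' ((c.actMatrix (Pi.single i x)).map (algebraMap ℚ ℂ))) (ρ x) :=
    (Submodule.span_singleton_le_iff_mem v _).mpr hmem
  refine (Submodule.eq_of_le_of_finrank_le hle ?_).symm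
  rw [c.finrank_eigenline_eq_one i ρ, finrank_span_singleton hv0]

end CMStructure

end Literature.AlgebraicGeometry.ModuliOfAbelianVarieties

end
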